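import Summits.QuantumFields.BalabanUV.Beta.GAN24.SliceFlatHeatSecond

/-!
# G-an2-4 ∕ (CONV-C), the SECOND-ORDER sup entries of the requester's refined (B5-1115-TABLE) line — flat supplier, part 2:
# TWO unit row differences of the product heat kernel on `(ℤ/P)^{d+1}`, block-localised, with ONE factor `T⁻¹`

G-an2-4 formalisation swarm `b2b-balaban-gan24-formalise-*`, leaf prover 03 (gen 48), crux team (2) under the coordinator ruling
«YM REDIRECT» (e34b3e0c); second file of the chain `SliceFlatHeatSecond → SliceFlatHeatTorusSecond → SliceFlatFreeHessian →
SliceFlatHessian` (the NE3 free-gradient chain of t4-ne3-p1 gen 15, ONE ORDER UP; end point: block row sums of the second unit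
differences of the flat `U = 1` propagator with a `(1 + log n)` allowance — the requester gan24-p2 gen 29's «pure second differences»
and «`G∇*∇*` row sums», journal `CLAIMS.log` l.28555).  Inputs BY NAME: part 9 of the NE3 chain (`SliceFlatHeatTorus`: the product
kernel `prodHeat`, its single row difference `prodHeat_rowDiff_eq`, the block-localisation `blockSum_le_weighted`, the fibre
dictionary `filter_blockPt_eq_piFinset`, the weighted torus bounds `weighted_sum_torusHeatKernel_le` ∕
`weighted_sum_fwdDiff_torusHeatKernel_le`) and part 1 of this chain (`weighted_sum_fwdSndDiff_torusHeatKernel_le`).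
 * §1 the DOUBLE row difference of the product kernel FACTORISES: for `μ = ν` into the forward second difference of the
   `ν`-th factor times the other `d` kernels (`prodHeat_rowDiff_rowDiff_eq_of_eq`), for `μ ≠ ν` into the two first differences
   of the `μ`-th and `ν`-th factors times the other `d − 1` kernels (`prodHeat_rowDiff_rowDiff_eq_of_ne`);
 * §2 **`blockSum_rowDiff_rowDiff_prodHeat_le`**: on `(ℤ/P)^{d+1}` with blocks of side `n` (`P = Q·n`), for `t > 0`, `T = 1 ∨ t`,
   `0 ≤ α ≤ 1/32`, every row `x`, block `y₁` and directions `μ, ν`: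
   `Σ_{z : blockPt z = y₁} |H_t(x+e_μ+e_ν,z) − H_t(x+e_μ,z) − H_t(x+e_ν,z) + H_t(x,z)|
      ≤ 33075·48^d·e^{α(d+1)}·T⁻¹·e^{16(d+1)(α/n)²T}·e^{−α·npl1(blockPt x − y₁)}`
   — ONE factor `T⁻¹` (two factors `T^{−1/2}`), EXPONENTIAL decay in the integer ℓ¹ block distance, constants free of `n, P, t`
   (`33075·48 = 1260²`, so one constant serves both cases).
Part 3 integrates this against the Laplace weight `e^{−t/n²}` of the massive free resolvent: `∫ (1∨2t)⁻¹e^{−t/(2n²)}dt ≤ 1 +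
log(1 + 2n²)` is the logarithm of the second-order entries.  Nothing here is specific to a gauge theory.

HONEST SCOPE.  Classical analysis of the free product heat kernel; no statement of Bałaban's is asserted or used; the sup → sup
SECOND-ORDER bound with `(1 + log n)` is OUR statement ([B5] (1.112) prints a Hölder-source bound, no logarithm) — not in print.
NOT (CONV-C), NEVER «G-an2-4 closed», NOT NE2 ∕ NE3, NOT D1, NOT BetaPertH, NOT continuum, NOT Clay; not in print — our
bookkeeping.  ABSOLUTE RULE of the cell kept: inputs are Mathlib and kernel-proved tree modules BY NAME; every declaration is a
definition-free [folklore] theorem; no `def … : Prop`, no `sorry`, no axioms beyond Mathlib's.  PLACEMENT (human rule 2026-08-19):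
our results under `Summits/QuantumFields/BalabanUV/`.  HONEST DEPENDENCY: continuum YM on T⁴ ⇐ BetaPertH ∧ nine spine estimates
(0/9 proved); BetaPertH ⇐ (D1) ∧ (D4) ∧ CAP+tail; G-an2-4 gates asym, D1 and NE2/3/4.
-/

noncomputable section

open Real Finset Filter

namespace Summit.QuantumFields.BalabanUV.Beta.GAN24.SliceFlatHeatTorusSecond

open Literature.Probability.LatticeModels
open Literature.MathematicalPhysics.QuantumFieldTheory.Balaban1983to89.B12Decay510Torus (pabs pabs_nonneg pl1_eq_sum)
open Summit.QuantumFields.BalabanUV.T4Continuum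
open SliceTorusBlocks SliceFlatHeatOneDim SliceFlatHeatWeighted SliceFlatHeatTorus
open Summit.QuantumFields.BalabanUV.Beta.GAN24.SliceFlatHeatSecond

/-! ## §1  The double row difference of the product kernel factorises -/
section Factorise

variable {d P : ℕ} [NeZero P]

/-- **Same direction**: `H(x+2e_ν,z) − 2H(x+e_ν,z) + H(x,z) = (q^P(c+2) − 2q^P(c+1) + q^P(c))·Π_{i≠ν} q^P(x_i−z_i)`, `c = x_ν − z_ν`.
[folklore] -/
theorem prodHeat_rowDiff_rowDiff_eq_of_eq (t : ℝ) (x z : Fin (d + 1) → ZMod P) (ν : Fin (d + 1)) :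
    prodHeat t (x + Pi.single ν 1 + Pi.single ν 1) z - prodHeat t (x + Pi.single ν 1) z
        - prodHeat t (x + Pi.single ν 1) z + prodHeat t x z
      = (torusHeatKernel t (x ν - z ν + 2) - 2 * torusHeatKernel t (x ν - z ν + 1) + torusHeatKernel t (x ν - z ν)) *
          ∏ i ∈ Finset.univ.erase ν, torusHeatKernel t (x i - z i) := by
  have h1 := prodHeat_rowDiff_eq t (x + Pi.single ν 1) z ν
  have h2 := prodHeat_rowDiff_eq t x z ν
  have hν : (x + Pi.single ν 1 : Fin (d + 1) → ZMod P) ν - z ν = x ν - z ν + 1 := by simp; ring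
  have hrest : ∏ i ∈ Finset.univ.erase ν, torusHeatKernel t ((x + Pi.single ν 1 : Fin (d + 1) → ZMod P) i - z i)
      = ∏ i ∈ Finset.univ.erase ν, torusHeatKernel t (x i - z i) :=
    Finset.prod_congr rfl fun i hi => by rw [Pi.add_apply, Pi.single_eq_of_ne (Finset.ne_of_mem_erase hi), add_zero]
  rw [hν, hrest] at h1
  have e2 : x ν - z ν + 1 + 1 = x ν - z ν + 2 := by ring
  rw [e2] at h1
  calc prodHeat t (x + Pi.single ν 1 + Pi.single ν 1) z - prodHeat t (x + Pi.single ν 1) z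
        - prodHeat t (x + Pi.single ν 1) z + prodHeat t x z
      = (prodHeat t (x + Pi.single ν 1 + Pi.single ν 1) z - prodHeat t (x + Pi.single ν 1) z)
        - (prodHeat t (x + Pi.single ν 1) z - prodHeat t x z) := by ring
    _ = _ := by rw [h1, h2]; ring

/-- **Distinct directions** `μ ≠ ν`: `H(x+e_μ+e_ν,z) − H(x+e_μ,z) − H(x+e_ν,z) + H(x,z) = (q^P(x_ν−z_ν+1) − q^P(x_ν−z_ν))·
(q^P(x_μ−z_μ+1) − q^P(x_μ−z_μ))·Π_{i≠ν,μ} q^P(x_i−z_i)`. [folklore] -/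
theorem prodHeat_rowDiff_rowDiff_eq_of_ne (t : ℝ) (x z : Fin (d + 1) → ZMod P) {μ ν : Fin (d + 1)} (hμν : μ ≠ ν) :
    prodHeat t (x + Pi.single μ 1 + Pi.single ν 1) z - prodHeat t (x + Pi.single μ 1) z
        - prodHeat t (x + Pi.single ν 1) z + prodHeat t x z
      = (torusHeatKernel t (x ν - z ν + 1) - torusHeatKernel t (x ν - z ν)) *
          (torusHeatKernel t (x μ - z μ + 1) - torusHeatKernel t (x μ - z μ)) *
          ∏ i ∈ (Finset.univ.erase ν).erase μ, torusHeatKernel t (x i - z i) := by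
  have h1 := prodHeat_rowDiff_eq t (x + Pi.single μ 1) z ν
  have h2 := prodHeat_rowDiff_eq t x z ν
  have hμmem : μ ∈ Finset.univ.erase ν := Finset.mem_erase.2 ⟨hμν, Finset.mem_univ μ⟩
  have hν : (x + Pi.single μ 1 : Fin (d + 1) → ZMod P) ν - z ν = x ν - z ν := by
    rw [Pi.add_apply, Pi.single_eq_of_ne hμν.symm, add_zero]
  have hsplit1 : ∏ i ∈ Finset.univ.erase ν, torusHeatKernel t ((x + Pi.single μ 1 : Fin (d + 1) → ZMod P) i - z i)
      = torusHeatKernel t (x μ - z μ + 1) * ∏ i ∈ (Finset.univ.erase ν).erase μ, torusHeatKernel t (x i - z i) := by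
    rw [← Finset.mul_prod_erase _ _ hμmem]
    have hμ : (x + Pi.single μ 1 : Fin (d + 1) → ZMod P) μ - z μ = x μ - z μ + 1 := by simp; ring
    rw [hμ]
    congr 1
    exact Finset.prod_congr rfl fun i hi => by
      rw [Pi.add_apply, Pi.single_eq_of_ne (Finset.ne_of_mem_erase hi), add_zero]
  have hsplit2 : ∏ i ∈ Finset.univ.erase ν, torusHeatKernel t (x i - z i)
      = torusHeatKernel t (x μ - z μ) * ∏ i ∈ (Finset.univ.erase ν).erase μ, torusHeatKernel t (x i - z i) := by
    rw [← Finset.mul_prod_erase _ _ hμmem]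
  rw [hν, hsplit1] at h1
  rw [hsplit2] at h2
  calc prodHeat t (x + Pi.single μ 1 + Pi.single ν 1) z - prodHeat t (x + Pi.single μ 1) z
        - prodHeat t (x + Pi.single ν 1) z + prodHeat t x z
      = (prodHeat t (x + Pi.single μ 1 + Pi.single ν 1) z - prodHeat t (x + Pi.single μ 1) z)
        - (prodHeat t (x + Pi.single ν 1) z - prodHeat t x z) := by ring
    _ = _ := by rw [h1, h2]; ring

end Factorise

/-! ## §2  The block-localised bound for the double row difference -/
section Product

variable {d P Q n : ℕ} [NeZero P] [NeZero Q]

/-- `1260² = 33075·48` and `8700 ≤ 33075`: one constant for both cases. [folklore] -/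
theorem const_cases : (1260 : ℝ) * 1260 = 33075 * 48 ∧ (8700 : ℝ) ≤ 33075 := by norm_num

/-- **THE BLOCK-LOCALISED DOUBLE-ROW-DIFFERENCE BOUND FOR THE PRODUCT HEAT KERNEL, SAME DIRECTION.** [folklore] -/
theorem blockSum_rowDiff_rowDiff_prodHeat_le_of_eq (hP : P = Q * n) {t : ℝ} (ht : 0 < t) {α : ℝ} (hα0 : 0 ≤ α)
    (hα : α ≤ 1 / 32) (x : Fin (d + 1) → ZMod P) (y₁ : Fin (d + 1) → ZMod Q) (ν : Fin (d + 1)) :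
    ∑ z ∈ Finset.univ.filter (fun z : Fin (d + 1) → ZMod P => blockPt Q n z = y₁),
        |prodHeat t (x + Pi.single ν 1 + Pi.single ν 1) z - prodHeat t (x + Pi.single ν 1) z
          - prodHeat t (x + Pi.single ν 1) z + prodHeat t x z|
      ≤ 33075 * 48 ^ d * Real.exp (α * (d + 1)) * (max 1 t)⁻¹ *
          Real.exp (16 * (d + 1) * (α / n) ^ 2 * max 1 t) * Real.exp (-(α * npl1 (blockPt Q n x - y₁))) := by
  classical
  have hn : 0 < n := pos_of_mul_eq hP
  have hn1 : (1 : ℝ) ≤ n := by exact_mod_cast hn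
  obtain ⟨hT1, hT0, -, -, -⟩ := max_one_facts t
  set T := max 1 t with hTdef
  set β : ℝ := α / n with hβdef
  have hβ0 : 0 ≤ β := div_nonneg hα0 (by positivity)
  have hβα : β ≤ α := div_le_self hα0 hn1
  have hβ32 : β ≤ 1 / 32 := hβα.trans hα
  have hβ16 : β ≤ 1 / 16 := hβ32.trans (by norm_num)
  set F : Fin (d + 1) → ZMod P → ℝ := fun i c =>
    if i = ν then |torusHeatKernel t (x i - c + 2) - 2 * torusHeatKernel t (x i - c + 1) + torusHeatKernel t (x i - c)|
      else |torusHeatKernel t (x i - c)| with hF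
  set Dc : Fin (d + 1) → ℝ := fun i => (pabs (blockOf Q n (x i) - y₁ i) : ℝ) with hDc
  set bnd : Fin (d + 1) → ℝ := fun i => Real.exp α * Real.exp (-(α * Dc i)) *
    (if i = ν then 8700 * T⁻¹ * Real.exp (8 * β ^ 2 * T) else 48 * Real.exp (4 * β ^ 2 * T)) with hbnd
  have hF0 : ∀ i c, 0 ≤ F i c := fun i c => by simp only [hF]; split_ifs <;> positivity
  have hfac : ∀ i, ∑ c ∈ Finset.univ.filter (fun c : ZMod P => blockOf Q n c = y₁ i), F i c ≤ bnd i := by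
    intro i
    by_cases hi : i = ν
    · have h := blockSum_le_weighted hP
        (fun c => torusHeatKernel t (c + 2) - 2 * torusHeatKernel t (c + 1) + torusHeatKernel t c) (x i) (y₁ i) hα0
      have hw := weighted_sum_fwdSndDiff_torusHeatKernel_le (P := P) ht hβ0 hβ32
      simp only [hF, hbnd, if_pos hi, hDc]
      refine h.trans ?_
      rw [hβdef] at hw ⊢
      exact mul_le_mul_of_nonneg_left hw (by positivity)
    · have h := blockSum_le_weighted hP (fun c => torusHeatKernel t c) (x i) (y₁ i) hα0
      have hw := weighted_sum_torusHeatKernel_le (P := P) ht hβ0 hβ16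
      simp only [hF, hbnd, if_neg hi, hDc]
      refine h.trans ?_
      rw [hβdef] at hw ⊢
      exact mul_le_mul_of_nonneg_left hw (by positivity)
  have hsum : ∑ z ∈ Finset.univ.filter (fun z : Fin (d + 1) → ZMod P => blockPt Q n z = y₁),
      |prodHeat t (x + Pi.single ν 1 + Pi.single ν 1) z - prodHeat t (x + Pi.single ν 1) z
          - prodHeat t (x + Pi.single ν 1) z + prodHeat t x z|
      = ∏ i, ∑ c ∈ Finset.univ.filter (fun c : ZMod P => blockOf Q n c = y₁ i), F i c := by
    rw [Finset.prod_univ_sum, filter_blockPt_eq_piFinset]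
    refine Finset.sum_congr rfl fun z _ => ?_
    rw [prodHeat_rowDiff_rowDiff_eq_of_eq, abs_mul, Finset.abs_prod, ← Finset.mul_prod_erase Finset.univ (fun i => F i (z i))
      (Finset.mem_univ ν)]
    simp only [hF, if_true]
    congr 1
    exact Finset.prod_congr rfl fun i hi => by rw [if_neg (Finset.ne_of_mem_erase hi)]
  rw [hsum]
  have hprod : ∏ i, ∑ c ∈ Finset.univ.filter (fun c : ZMod P => blockOf Q n c = y₁ i), F i c ≤ ∏ i, bnd i :=
    Finset.prod_le_prod (fun i _ => Finset.sum_nonneg fun c _ => hF0 i c) fun i _ => hfac i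
  refine hprod.trans ?_
  have hsplit : ∏ i, bnd i = (∏ i : Fin (d + 1), Real.exp α) * (∏ i, Real.exp (-(α * Dc i))) *
      ∏ i, (if i = ν then 8700 * T⁻¹ * Real.exp (8 * β ^ 2 * T) else 48 * Real.exp (4 * β ^ 2 * T)) := by
    simp only [hbnd, Finset.prod_mul_distrib]
  have h1 : ∏ _i : Fin (d + 1), Real.exp α = Real.exp (α * (d + 1)) := by
    rw [Finset.prod_const, Finset.card_univ, Fintype.card_fin, ← Real.exp_nat_mul]; push_cast; ring_nf
  have h2 : ∏ i, Real.exp (-(α * Dc i)) = Real.exp (-(α * npl1 (blockPt Q n x - y₁))) := by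
    rw [← Real.exp_sum, cast_npl1, pl1_eq_sum, Finset.mul_sum, ← Finset.sum_neg_distrib]
    rfl
  have h3 : ∏ i, (if i = ν then 8700 * T⁻¹ * Real.exp (8 * β ^ 2 * T) else 48 * Real.exp (4 * β ^ 2 * T))
      = 8700 * T⁻¹ * Real.exp (8 * β ^ 2 * T) * (48 * Real.exp (4 * β ^ 2 * T)) ^ d := by
    rw [← Finset.mul_prod_erase _ _ (Finset.mem_univ ν), if_pos rfl]
    congr 1
    rw [Finset.prod_congr rfl fun i hi => if_neg (Finset.ne_of_mem_erase hi), Finset.prod_const,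
      Finset.card_erase_of_mem (Finset.mem_univ ν), Finset.card_univ, Fintype.card_fin, Nat.add_sub_cancel]
  have hkey : Real.exp (8 * β ^ 2 * T) * Real.exp (4 * β ^ 2 * T) ^ d ≤ Real.exp (16 * (d + 1) * (α / n) ^ 2 * T) := by
    rw [← Real.exp_nat_mul, ← Real.exp_add, hβdef]
    refine Real.exp_le_exp.2 ?_
    have : 0 ≤ (α / n) ^ 2 * T := by positivity
    nlinarith [(Nat.cast_nonneg d : (0:ℝ) ≤ d)]
  set A : ℝ := 48 ^ d * Real.exp (α * (d + 1)) * T⁻¹ * Real.exp (-(α * npl1 (blockPt Q n x - y₁))) with hA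
  have hA0 : 0 ≤ A := by rw [hA]; positivity
  have hE0 : 0 ≤ Real.exp (16 * (d + 1) * (α / n) ^ 2 * T) := (Real.exp_pos _).le
  calc ∏ i, bnd i = 8700 * A * (Real.exp (8 * β ^ 2 * T) * Real.exp (4 * β ^ 2 * T) ^ d) := by
        rw [hsplit, h1, h2, h3, hA, mul_pow]; ring
    _ ≤ 8700 * A * Real.exp (16 * (d + 1) * (α / n) ^ 2 * T) := mul_le_mul_of_nonneg_left hkey (by positivity)
    _ ≤ 33075 * A * Real.exp (16 * (d + 1) * (α / n) ^ 2 * T) := by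
        have := const_cases.2
        gcongr
    _ = _ := by rw [hA]; ring

/-- **THE BLOCK-LOCALISED DOUBLE-ROW-DIFFERENCE BOUND FOR THE PRODUCT HEAT KERNEL, DISTINCT DIRECTIONS** (`μ ≠ ν`). [folklore] -/
theorem blockSum_rowDiff_rowDiff_prodHeat_le_of_ne (hP : P = Q * n) {t : ℝ} (ht : 0 < t) {α : ℝ} (hα0 : 0 ≤ α)
    (hα : α ≤ 1 / 32) (x : Fin (d + 1) → ZMod P) (y₁ : Fin (d + 1) → ZMod Q) {μ ν : Fin (d + 1)} (hμν : μ ≠ ν) :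
    ∑ z ∈ Finset.univ.filter (fun z : Fin (d + 1) → ZMod P => blockPt Q n z = y₁),
        |prodHeat t (x + Pi.single μ 1 + Pi.single ν 1) z - prodHeat t (x + Pi.single μ 1) z
          - prodHeat t (x + Pi.single ν 1) z + prodHeat t x z|
      ≤ 33075 * 48 ^ d * Real.exp (α * (d + 1)) * (max 1 t)⁻¹ *
          Real.exp (16 * (d + 1) * (α / n) ^ 2 * max 1 t) * Real.exp (-(α * npl1 (blockPt Q n x - y₁))) := by
  classical
  have hn : 0 < n := pos_of_mul_eq hP
  have hn1 : (1 : ℝ) ≤ n := by exact_mod_cast hn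
  obtain ⟨hT1, hT0, hThalf, hTT, -⟩ := max_one_facts t
  set T := max 1 t with hTdef
  set β : ℝ := α / n with hβdef
  have hβ0 : 0 ≤ β := div_nonneg hα0 (by positivity)
  have hβα : β ≤ α := div_le_self hα0 hn1
  have hβ32 : β ≤ 1 / 32 := hβα.trans hα
  have hβ16 : β ≤ 1 / 16 := hβ32.trans (by norm_num)
  -- `d ≥ 1` since there are two distinct directions
  have hd1 : 1 ≤ d := by
    by_contra h0
    have hd0 : d = 0 := by omega
    subst hd0
    have h1 := μ.isLt
    have h2 := ν.isLt
    exact hμν (Fin.ext (by omega))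
  have hμmem : μ ∈ Finset.univ.erase ν := Finset.mem_erase.2 ⟨hμν, Finset.mem_univ μ⟩
  set F : Fin (d + 1) → ZMod P → ℝ := fun i c =>
    if i = ν ∨ i = μ then |torusHeatKernel t (x i - c + 1) - torusHeatKernel t (x i - c)|
      else |torusHeatKernel t (x i - c)| with hF
  set Dc : Fin (d + 1) → ℝ := fun i => (pabs (blockOf Q n (x i) - y₁ i) : ℝ) with hDc
  set bnd : Fin (d + 1) → ℝ := fun i => Real.exp α * Real.exp (-(α * Dc i)) *
    (if i = ν ∨ i = μ then 1260 * T ^ (-(1 / 2 : ℝ)) * Real.exp (8 * β ^ 2 * T) else 48 * Real.exp (4 * β ^ 2 * T)) with hbnd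
  have hF0 : ∀ i c, 0 ≤ F i c := fun i c => by simp only [hF]; split_ifs <;> positivity
  have hfac : ∀ i, ∑ c ∈ Finset.univ.filter (fun c : ZMod P => blockOf Q n c = y₁ i), F i c ≤ bnd i := by
    intro i
    by_cases hi : i = ν ∨ i = μ
    · have h := blockSum_le_weighted hP (fun c => torusHeatKernel t (c + 1) - torusHeatKernel t c) (x i) (y₁ i) hα0
      have hw := weighted_sum_fwdDiff_torusHeatKernel_le (P := P) ht hβ0 hβ32
      simp only [hF, hbnd, if_pos hi, hDc]
      refine h.trans ?_
      rw [hβdef] at hw ⊢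
      exact mul_le_mul_of_nonneg_left hw (by positivity)
    · have h := blockSum_le_weighted hP (fun c => torusHeatKernel t c) (x i) (y₁ i) hα0
      have hw := weighted_sum_torusHeatKernel_le (P := P) ht hβ0 hβ16
      simp only [hF, hbnd, if_neg hi, hDc]
      refine h.trans ?_
      rw [hβdef] at hw ⊢
      exact mul_le_mul_of_nonneg_left hw (by positivity)
  have hsum : ∑ z ∈ Finset.univ.filter (fun z : Fin (d + 1) → ZMod P => blockPt Q n z = y₁),
      |prodHeat t (x + Pi.single μ 1 + Pi.single ν 1) z - prodHeat t (x + Pi.single μ 1) z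
          - prodHeat t (x + Pi.single ν 1) z + prodHeat t x z|
      = ∏ i, ∑ c ∈ Finset.univ.filter (fun c : ZMod P => blockOf Q n c = y₁ i), F i c := by
    rw [Finset.prod_univ_sum, filter_blockPt_eq_piFinset]
    refine Finset.sum_congr rfl fun z _ => ?_
    rw [prodHeat_rowDiff_rowDiff_eq_of_ne t x z hμν, abs_mul, abs_mul, Finset.abs_prod,
      ← Finset.mul_prod_erase Finset.univ (fun i => F i (z i)) (Finset.mem_univ ν),
      ← Finset.mul_prod_erase _ (fun i => F i (z i)) hμmem]
    have eν : F ν (z ν) = |torusHeatKernel t (x ν - z ν + 1) - torusHeatKernel t (x ν - z ν)| := by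
      simp only [hF, true_or, if_true]
    have eμ : F μ (z μ) = |torusHeatKernel t (x μ - z μ + 1) - torusHeatKernel t (x μ - z μ)| := by
      simp only [hF, or_true, if_true]
    rw [eν, eμ, mul_assoc]
    congr 2
    exact Finset.prod_congr rfl fun i hi => by
      have hiμ : i ≠ μ := Finset.ne_of_mem_erase hi
      have hiν : i ≠ ν := Finset.ne_of_mem_erase (Finset.mem_of_mem_erase hi)
      simp only [hF, hiμ, hiν, or_self, if_false]
  rw [hsum]
  have hprod : ∏ i, ∑ c ∈ Finset.univ.filter (fun c : ZMod P => blockOf Q n c = y₁ i), F i c ≤ ∏ i, bnd i :=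
    Finset.prod_le_prod (fun i _ => Finset.sum_nonneg fun c _ => hF0 i c) fun i _ => hfac i
  refine hprod.trans ?_
  have hsplit : ∏ i, bnd i = (∏ i : Fin (d + 1), Real.exp α) * (∏ i, Real.exp (-(α * Dc i))) *
      ∏ i, (if i = ν ∨ i = μ then 1260 * T ^ (-(1 / 2 : ℝ)) * Real.exp (8 * β ^ 2 * T) else 48 * Real.exp (4 * β ^ 2 * T)) := by
    simp only [hbnd, Finset.prod_mul_distrib]
  have h1 : ∏ _i : Fin (d + 1), Real.exp α = Real.exp (α * (d + 1)) := by
    rw [Finset.prod_const, Finset.card_univ, Fintype.card_fin, ← Real.exp_nat_mul]; push_cast; ring_nf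
  have h2 : ∏ i, Real.exp (-(α * Dc i)) = Real.exp (-(α * npl1 (blockPt Q n x - y₁))) := by
    rw [← Real.exp_sum, cast_npl1, pl1_eq_sum, Finset.mul_sum, ← Finset.sum_neg_distrib]
    rfl
  have hcard : ((Finset.univ.erase ν).erase μ).card = d - 1 := by
    rw [Finset.card_erase_of_mem hμmem, Finset.card_erase_of_mem (Finset.mem_univ ν), Finset.card_univ, Fintype.card_fin]
    omega
  have h3 : ∏ i, (if i = ν ∨ i = μ then 1260 * T ^ (-(1 / 2 : ℝ)) * Real.exp (8 * β ^ 2 * T) else 48 * Real.exp (4 * β ^ 2 * T))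
      = (1260 * T ^ (-(1 / 2 : ℝ)) * Real.exp (8 * β ^ 2 * T)) * ((1260 * T ^ (-(1 / 2 : ℝ)) * Real.exp (8 * β ^ 2 * T)) *
          (48 * Real.exp (4 * β ^ 2 * T)) ^ (d - 1)) := by
    rw [← Finset.mul_prod_erase _ _ (Finset.mem_univ ν), ← Finset.mul_prod_erase _ _ hμmem,
      if_pos (Or.inl rfl), if_pos (Or.inr rfl)]
    congr 2
    rw [Finset.prod_congr rfl fun i hi => ?_, Finset.prod_const, hcard]
    have hiμ : i ≠ μ := Finset.ne_of_mem_erase hi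
    have hiν : i ≠ ν := Finset.ne_of_mem_erase (Finset.mem_of_mem_erase hi)
    simp only [hiμ, hiν, or_self, if_false]
  have hkey : Real.exp (8 * β ^ 2 * T) * Real.exp (8 * β ^ 2 * T) * Real.exp (4 * β ^ 2 * T) ^ (d - 1)
      ≤ Real.exp (16 * (d + 1) * (α / n) ^ 2 * T) := by
    rw [← Real.exp_nat_mul, ← Real.exp_add, ← Real.exp_add, hβdef]
    refine Real.exp_le_exp.2 ?_
    have h0 : 0 ≤ (α / n) ^ 2 * T := by positivity
    have hdd : ((d - 1 : ℕ) : ℝ) ≤ d := by exact_mod_cast Nat.sub_le d 1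
    nlinarith [(Nat.cast_nonneg (d - 1) : (0:ℝ) ≤ ((d - 1 : ℕ) : ℝ))]
  have h48 : (48 : ℝ) ^ d = 48 * 48 ^ (d - 1) := by
    rw [← pow_succ']; congr 1; omega
  set A : ℝ := 48 ^ (d - 1) * Real.exp (α * (d + 1)) * T⁻¹ * Real.exp (-(α * npl1 (blockPt Q n x - y₁))) with hA
  have hA0 : 0 ≤ A := by rw [hA]; positivity
  calc ∏ i, bnd i = (1260 * 1260) * A *
        (Real.exp (8 * β ^ 2 * T) * Real.exp (8 * β ^ 2 * T) * Real.exp (4 * β ^ 2 * T) ^ (d - 1)) := by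
        rw [hsplit, h1, h2, h3, hA, mul_pow, ← hTT]; ring
    _ ≤ (1260 * 1260) * A * Real.exp (16 * (d + 1) * (α / n) ^ 2 * T) := mul_le_mul_of_nonneg_left hkey (by positivity)
    _ = _ := by rw [const_cases.1, hA, h48]; ring

/-- **THE BLOCK-LOCALISED DOUBLE-ROW-DIFFERENCE BOUND FOR THE PRODUCT HEAT KERNEL.**  On `(ℤ/P)^{d+1}` with blocks of side `n`
(`P = Q·n`), for `t > 0`, `T = 1 ∨ t`, `0 ≤ α ≤ 1/32`, every row `x`, block `y₁` and directions `μ, ν`: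
`Σ_{z : blockPt z = y₁} |H_t(x+e_μ+e_ν,z) − H_t(x+e_μ,z) − H_t(x+e_ν,z) + H_t(x,z)|
  ≤ 33075·48^d·e^{α(d+1)}·T⁻¹·e^{16(d+1)(α/n)²T}·e^{−α·npl1(blockPt x − y₁)}` — ONE factor `T⁻¹`. [folklore] -/
theorem blockSum_rowDiff_rowDiff_prodHeat_le (hP : P = Q * n) {t : ℝ} (ht : 0 < t) {α : ℝ} (hα0 : 0 ≤ α) (hα : α ≤ 1 / 32)
    (x : Fin (d + 1) → ZMod P) (y₁ : Fin (d + 1) → ZMod Q) (μ ν : Fin (d + 1)) :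
    ∑ z ∈ Finset.univ.filter (fun z : Fin (d + 1) → ZMod P => blockPt Q n z = y₁),
        |prodHeat t (x + Pi.single μ 1 + Pi.single ν 1) z - prodHeat t (x + Pi.single μ 1) z
          - prodHeat t (x + Pi.single ν 1) z + prodHeat t x z|
      ≤ 33075 * 48 ^ d * Real.exp (α * (d + 1)) * (max 1 t)⁻¹ *
          Real.exp (16 * (d + 1) * (α / n) ^ 2 * max 1 t) * Real.exp (-(α * npl1 (blockPt Q n x - y₁))) := by
  by_cases hμν : μ = ν
  · subst hμν
    exact blockSum_rowDiff_rowDiff_prodHeat_le_of_eq hP ht hα0 hα x y₁ μ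
  · exact blockSum_rowDiff_rowDiff_prodHeat_le_of_ne hP ht hα0 hα x y₁ hμν

end Product

end Summit.QuantumFields.BalabanUV.Beta.GAN24.SliceFlatHeatTorusSecond
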